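import Summits.BirchSwinnertonDyer.BirchSwinnertonDyer.Theorems.PAdicOrderV2PAdicOrderThesisR2StubUBRank0

/-!
# BirchSwinnertonDyer / PAdicOrderV2 — crux `PAdicOrderThesisR2` (stmt-0487): split glue D6

(Statement and proof: crux-strategist s2, `Cruxes/PAdicOrderThesisR2/SplitGlueS2.lean`;
landed under `Theorems/` by the line lead a3 as the registered composition stub
`PAdicOrderThesisR2_of_subs` of the rank-cell decomposition.)

The thesis node `X = PAdicOrderThesisR2` of route `PAdicOrderV2`
(∀ E/ℚ globally minimal `W`, ∃ good ordinary `p`, ∃ newform `f` of `W`: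
`ord_T L_p(f, α_p, T) = r_an(W)` and `ord_T L_p(f, α_p, T) = r_MW(W)`)
from FIVE children, the rank-cell refinement of the Kato sandwich
(`padicOrderThesisR2_of_sandwich`, p96594):

* `hmod`  — C1 `PAdicOrderModularity` (support; Breuil–Conrad–Diamond–Taylor 2001 Thm A, the
  inlined body of `ModularForms.exists_isNewformOf`, byte-identical to the antecedent of the
  proved route support `CruxesToThesis`);
* `hkato` — C2 `PAdicOrderKatoSideR2` (support; the route's existing item stmt-0491, Kato 2004
  Thm 17.4/18.4: `r_MW ≤ ord_T L_p` at every odd good ordinary prime);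
* `hUB1`  — C3 `PAdicOrderOnePrimeUBRankOne` (crux): in analytic rank ONE, some good ordinary
  `p ≥ 5` with `ord_T L_p(f, α_p, T) ≤ r_an` for every newform `f` of `E` (⟸ one height
  non-Wieferich prime, `onePrimeUBRankOne_of_heightNonWieferich`, p144815, modulo GZK and the
  rank-one `p`-adic Gross–Zagier consequence; CM: Bertrand 1982);
* `hUB2`  — C4 `PAdicOrderOnePrimeUBHigherRank` (crux): the same in analytic rank `≥ 2` (one
  non-zero Taylor coefficient of index `≤ r_an` at one ordinary prime; open, no tool in print);
* `hLB`   — C5 `PAdicOrderBSDLowerBound` (crux): `r_an(W) ≤ r_MW(W)` for every globally minimal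
  elliptic `W` — the lower-bound half of BSD (rank `≤ 1`: Gross–Zagier–Kolyvagin; rank `≥ 2`: the
  summit's open half, kernel-checked NECESSARY for `X`, `stub_LB_ge2_of_thesis`, p100810).

Proof: `padicOrderThesisR2_of_sandwich` with its `hUB` assembled from C3/C4 by cases on
`r_an = 1 ∨ 2 ≤ r_an`, and its `hLB1`, `hLB2` read off C5. The upper-bound half of BSD is EARNED
inside the sandwich (`r_MW ≤ ord_T L_p ≤ r_an`: Kato + C3/C4; rank 0 by the proved interpolation
stub `stub_UB_rank0`, p96136); only the lower bound is imported (C5).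
-/

-- single-conjunct summit: `Summit.BirchSwinnertonDyer.BirchSwinnertonDyer.…` repeats the name by design
set_option linter.dupNamespace false

namespace Summit.BirchSwinnertonDyer.BirchSwinnertonDyer.Cruxes.PAdicOrderThesisR2.KatoSandwich

open Literature.NumberTheory.EllipticCurves Literature.NumberTheory.EllipticCurves.ModularForms
open Summit.BirchSwinnertonDyer.BirchSwinnertonDyer.Theses

/-- **Split glue for the thesis node `X = PAdicOrderThesisR2`** (crux-strategist s2, 2026-08-17):
modularity → Kato side → one-prime `p`-adic upper bound in analytic rank `1` → the same in analytic
rank `≥ 2` → BSD lower bound (globally minimal models) → `X`. A corollary of the Kato sandwich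
`padicOrderThesisR2_of_sandwich` (p96594): its positive-rank upper-bound hypothesis is the
conjunction of the two rank cells, and its two lower-bound hypotheses are the rank-`1` and
rank-`≥ 2` instances of `r_an ≤ r_MW`. [cite: MazurTateTeitelbaum1986Invent, §II.10] -/
theorem PAdicOrderThesisR2_of_subs :
    (∀ (W : WeierstrassCurve ℚ) [W.IsElliptic] [NeZero (W.conductorNorm ℤ)],
      ∃ f : CuspForm (CongruenceSubgroup.Gamma0 (W.conductorNorm ℤ)) 2, IsNewformOf W f) →
    Summit.BirchSwinnertonDyer.BirchSwinnertonDyer.Theses.PAdicOrderV2.PAdicOrderKatoSideR2 →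
    (∀ (W : WeierstrassCurve ℚ) [W.IsElliptic] [W.IsGloballyMinimal], W.analyticRank = 1 →
      ∃ (p : ℕ) (_ : Fact p.Prime), 5 ≤ p ∧ IsOrdinaryAt W p ∧
        ∀ {N : ℕ} [NeZero N] (f : CuspForm (CongruenceSubgroup.Gamma0 N) 2), IsNewformOf W f →
          (padicLFunction f (unitRoot W p : ℚ_[p])).order ≤ (W.analyticRank : ℕ∞)) →
    (∀ (W : WeierstrassCurve ℚ) [W.IsElliptic] [W.IsGloballyMinimal], 2 ≤ W.analyticRank →
      ∃ (p : ℕ) (_ : Fact p.Prime), 5 ≤ p ∧ IsOrdinaryAt W p ∧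
        ∀ {N : ℕ} [NeZero N] (f : CuspForm (CongruenceSubgroup.Gamma0 N) 2), IsNewformOf W f →
          (padicLFunction f (unitRoot W p : ℚ_[p])).order ≤ (W.analyticRank : ℕ∞)) →
    (∀ (W : WeierstrassCurve ℚ) [W.IsElliptic] [W.IsGloballyMinimal],
      W.analyticRank ≤ W.mordellWeilRank) →
    Summit.BirchSwinnertonDyer.BirchSwinnertonDyer.Theses.PAdicOrderV2.PAdicOrderThesisR2 := by
  intro hmod hkato hUB1 hUB2 hLB
  refine padicOrderThesisR2_of_sandwich hmod hkato ?_ ?_ ?_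
  · -- the positive-rank one-prime upper bound, by rank cells
    intro W _ _ hpos
    rcases Nat.lt_or_ge W.analyticRank 2 with h1 | h2
    · exact hUB1 W (by omega)
    · exact hUB2 W h2
  · -- analytic rank one: `1 ≤ r_MW`
    intro W _ _ h1
    have h := hLB W
    rw [h1] at h
    exact h
  · -- analytic rank `≥ 2`: `r_an ≤ r_MW`
    intro W _ _ _
    exact hLB W

end Summit.BirchSwinnertonDyer.BirchSwinnertonDyer.Cruxes.PAdicOrderThesisR2.KatoSandwich
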